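import Summits.ABC.IUTFork.Joshi.ThetaLociSizes
import Summits.ABC.IUTFork.Joshi.ThetaEvaluationLogShells
import Literature.NumberTheory.EllipticCurves.PAdicHeightsLogProofs
import HarnessLib

/-!
# Joshi, *Arithmetic Teichmüller Spaces III* (arXiv:2401.13508v4) Lemma 9.8.2.7 — DISCHARGED over `ℚ_p`

Proof-only companion of `Joshi/ThetaLociSizes.lean` (abc-iut cell, branch E, rung LADDER-ABC:A2.E; seat abc-iut-E-t22, slot
T-22). Lemma 9.8.2.7 (p.117 l.159–161 of the render `HOME/lit/renders/Joshi-arxiv-2401.13508/`): «Let `E` be a p-adic field and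
let `|−|_E` be a p-adic absolute value on `E`. Then for all `x ∈ (p*·𝒪_E) − {0}` one has `|log_E(1+x)|_E = |x|_E`» (`p* = p` for
odd `p`, `p* = 4` for `p = 2`, (9.6.1.2) p.108 — abc-iut-E-t21's `ATS3.pStar`); proof p.118 – p.119 l.22 after [Koblitz 1984,
IV.1]. It was TYPED as the predicate `ATS3.LogOnePlusNormEq E logE p*` on an abstract logarithm because neither Mathlib nor the
tree has a `p`-adic logarithm for a general `p`-adic field `E`.

Here it is PROVED for `E = ℚ_p` (every prime `p`, the case `p = 2` included with `p* = 4`) for the tree's Iwasawa logarithm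
`Literature.NumberTheory.EllipticCurves.padicLog` (Iwasawa 1972 §4.4), from the tree's isometry of the logarithmic series
`norm_padicLogSeries_eq : ‖1 − y‖ < ‖2‖ → ‖L(y)‖ = ‖1 − y‖` and `padicLog_eq_padicLogSeries` (abc-iut's
`PAdicHeightsLogProofs`): for `x ≠ 0` with `‖x‖ ≤ ‖p*‖` one has `‖1 − (1+x)‖ = ‖x‖ ≤ ‖p*‖ < ‖2‖` (`‖p‖ = p⁻¹ < 1 = ‖2‖` for odd
`p`; `‖4‖ = 1/4 < 1/2 = ‖2‖` for `p = 2`), so `‖log_p(1+x)‖ = ‖L(1+x)‖ = ‖x‖`. The general finite extension `E/ℚ_p` stays the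
typed predicate (TODO(general form): Lemma 9.8.2.7 for any `p`-adic field `E`, which needs a logarithm on `E`). Nothing of Joshi's
construction and no clause of [IUTchIII] Cor. 3.12 is asserted; no side taken. [claim: Joshi2024ATS3, status: disputed]
-/

noncomputable section

namespace Summit.ABC.IUTFork.Joshi.ATS3

open Literature.NumberTheory.EllipticCurves

variable (p : ℕ) [Fact p.Prime]

/-- `‖(p* : ℚ_p)‖ < ‖(2 : ℚ_p)‖`: for odd `p`, `‖p‖ = p⁻¹ < 1 = ‖2‖`; for `p = 2`, `‖4‖ = 2⁻² < 2⁻¹ = ‖2‖` — the radius on which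
the logarithmic series is an isometry (Rmk. 9.7.1.2 p.110 l.22–45: the case split behind `p*`). [folklore] -/
theorem norm_pStar_lt_norm_two : ‖((pStar p : ℕ) : ℚ_[p])‖ < ‖(2 : ℚ_[p])‖ := by
  have hp : p.Prime := Fact.out
  by_cases h2 : p = 2
  · subst h2
    have h : ‖((2 : ℕ) : ℚ_[2])‖ = (2 : ℝ)⁻¹ := by exact_mod_cast Padic.norm_p (p := 2)
    rw [pStar_two, show ((4 : ℕ) : ℚ_[2]) = ((2 : ℕ) : ℚ_[2]) ^ 2 by norm_num, norm_pow,
      show (2 : ℚ_[2]) = ((2 : ℕ) : ℚ_[2]) by norm_num, h]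
    norm_num
  · rw [pStar_of_ne_two h2]
    have h2' : ‖(2 : ℚ_[p])‖ = 1 := by
      rw [show (2 : ℚ_[p]) = ((2 : ℕ) : ℚ_[p]) by norm_cast, Padic.norm_natCast_eq_one_iff]
      exact ((Nat.coprime_primes Nat.prime_two hp).mpr (Ne.symm h2)).symm
    rw [h2', Padic.norm_p]
    exact inv_lt_one_of_one_lt₀ (by exact_mod_cast hp.one_lt)

/-- **Lemma 9.8.2.7 DISCHARGED for `E = ℚ_p`** (every prime `p`; `p* = 4` when `p = 2`): for `x ∈ p*·ℤ_p ∖ {0}`,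
`‖log_p(1 + x)‖ = ‖x‖`, for the tree's Iwasawa logarithm `padicLog`. [claim: Joshi2024ATS3, status: disputed] -/
theorem logOnePlusNormEq_padic : LogOnePlusNormEq ℚ_[p] (padicLog p) ((pStar p : ℕ) : ℚ_[p]) := by
  intro x _hx hxp
  have h1 : ‖1 - (1 + x)‖ = ‖x‖ := by
    rw [show (1 : ℚ_[p]) - (1 + x) = -x by ring, norm_neg]
  have hlt2 : ‖1 - (1 + x)‖ < ‖(2 : ℚ_[p])‖ := by
    rw [h1]; exact hxp.trans_lt (norm_pStar_lt_norm_two p)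
  have hlt1 : ‖1 - (1 + x)‖ < 1 :=
    hlt2.trans_le (by simpa using norm_natCast_le_one (p := p) 2)
  rw [padicLog_eq_padicLogSeries hlt1, norm_padicLogSeries_eq hlt2, h1]

/-- The same in Joshi's letters with `p*` for odd `p`: `‖log_p(1 + x)‖ = ‖x‖` whenever `0 ≠ x ∈ p·ℤ_p`. [folklore] -/
theorem norm_padicLog_one_add_of_ne_two (hp2 : p ≠ 2) {x : ℚ_[p]} (hx : x ≠ 0) (hxp : ‖x‖ ≤ ‖(p : ℚ_[p])‖) :
    ‖padicLog p (1 + x)‖ = ‖x‖ := by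
  refine logOnePlusNormEq_padic p x hx ?_
  rwa [pStar_of_ne_two hp2]

end Summit.ABC.IUTFork.Joshi.ATS3

end
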